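import Mathlib
import HarnessLib
import Summits.NavierStokesRegularity.NavierStokesRegularity.Theorems.HalfSpaceWindowDoorCirculationCarryingRigidityGaussTilting

/-!
# Route `HalfSpaceWindowDoor`, crux `CirculationCarryingRigidity` (stmt-NavierStokesRegularity-25311) — line «gauss-swirl»:
# Gaussian product identity, shifted second moments and the inner AXIS integrals (tools for the axis-averaging law of
# `…GaussAxisAverage`)

LEAD ns-hsw-p1 g6 (cell pub-ns-dss), `--supports 25311 --as helper`; pure Gaussian calculus on `ℝ³` (own text, not part of the
ideator's file):

* `norm_sq_complete_square`, `heatKernel_mul_heatKernel_eq` — completing the square: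
  `G_T(z − y)·G_t(y) = G_{t+T}(z)·G_σ(y − m)`, `σ = tT/(t+T)`, `m = (t/(t+T))z`;
* `integral_heatKernel_shift_mul_inner_mul_inner` — shifted second moments `∫ G_σ(y − m)⟪y,a⟫⟪y,b⟫dy = ⟪m,a⟫⟪m,b⟫ + 2σ⟪a,b⟫`,
  and `integral_heatKernel_shift_mul_norm_sq` — `∫ G_σ(y − m)‖y‖²dy = ‖m‖² + 6σ`;
* `integral_axis_heatKernel_mul_inner_mul_inner` — the inner axis integral
  `∫ G_T(x₀ − xc)G_t(x − x₀)⟪x−x₀,a⟫⟪x−x₀,b⟫dx₀ = G_{t+T}(x − xc)[(t/(t+T))²⟪x−xc,a⟫⟪x−xc,b⟫ + 2σ⟪a,b⟫]`,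
  and `integral_axis_heatKernel_mul_norm_sq` — the same with `‖x − x₀‖²` (`… [(t/(t+T))²‖x−xc‖² + 6σ]`).

WHAT THIS IS NOT: not a statement about Navier–Stokes regularity (Clay A); calculus lemmas only; item 25311 stays OPEN.
-/

noncomputable section

-- the summit and its single sub-problem share the name (CONVENTIONS §1), as in every Theorems file
set_option linter.dupNamespace false

namespace Summit.NavierStokesRegularity.NavierStokesRegularity.Theorems.HalfSpaceWindowDoorCirculationCarryingRigidityGaussProduct

open scoped BigOperators Topology InnerProductSpace RealInnerProductSpace
open Filter Set Function MeasureTheory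
open Literature.Analysis Literature.Analysis.FluidPDE Literature.Analysis.UnboundedOperators

/-! ### The Gaussian product identity (completing the square) -/

/-- Completing the square: `‖z − y‖²/T + ‖y‖²/t = ‖y − (t/(t+T))z‖²·(t+T)/(tT) + ‖z‖²/(t+T)` (`t, T > 0`). -/
theorem norm_sq_complete_square {t T : ℝ} (ht : 0 < t) (hT : 0 < T) (z y : EuclideanSpace ℝ (Fin 3)) :
    ‖z - y‖ ^ 2 / T + ‖y‖ ^ 2 / t =
      ‖y - (t / (t + T)) • z‖ ^ 2 * ((t + T) / (t * T)) + ‖z‖ ^ 2 / (t + T) := by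
  have htT : 0 < t + T := by linarith
  rw [norm_sub_sq_real, norm_sub_sq_real, norm_smul, inner_smul_right, Real.norm_eq_abs, abs_of_pos (by positivity),
    mul_pow]
  field_simp
  rw [real_inner_comm y z]
  ring

/-- **Gaussian product identity.**  `G_T(z − y)·G_t(y) = G_{t+T}(z)·G_σ(y − m)` with `σ = tT/(t+T)`, `m = (t/(t+T))z`. -/
theorem heatKernel_mul_heatKernel_eq {t T : ℝ} (ht : 0 < t) (hT : 0 < T) (z y : EuclideanSpace ℝ (Fin 3)) :
    heatKernel T (z - y) * heatKernel t y =
      heatKernel (t + T) z * heatKernel (t * T / (t + T)) (y - (t / (t + T)) • z) := by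
  have htT : 0 < t + T := by linarith
  have hσ : 0 < t * T / (t + T) := by positivity
  simp only [heatKernel, finrank_euclideanSpace_fin]
  -- prefactors: `(4πT)^a (4πt)^a = (4π(t+T))^a (4πσ)^a` since `T t = (t+T) σ`
  have hpre : (4 * Real.pi * T) ^ (-((3 : ℕ) : ℝ) / 2) * (4 * Real.pi * t) ^ (-((3 : ℕ) : ℝ) / 2) =
      (4 * Real.pi * (t + T)) ^ (-((3 : ℕ) : ℝ) / 2) * (4 * Real.pi * (t * T / (t + T))) ^ (-((3 : ℕ) : ℝ) / 2) := by
    rw [← Real.mul_rpow (by positivity) (by positivity), ← Real.mul_rpow (by positivity) (by positivity)]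
    congr 1
    field_simp
  -- exponents: completing the square
  have hexp : Real.exp (-‖z - y‖ ^ 2 / (4 * T)) * Real.exp (-‖y‖ ^ 2 / (4 * t)) =
      Real.exp (-‖z‖ ^ 2 / (4 * (t + T))) * Real.exp (-‖y - (t / (t + T)) • z‖ ^ 2 / (4 * (t * T / (t + T)))) := by
    rw [← Real.exp_add, ← Real.exp_add]
    congr 1
    have h := norm_sq_complete_square ht hT z y
    have h4 : -‖z - y‖ ^ 2 / (4 * T) + -‖y‖ ^ 2 / (4 * t) = -(1/4) * (‖z - y‖ ^ 2 / T + ‖y‖ ^ 2 / t) := by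
      field_simp
      ring
    rw [h4, h]
    field_simp
    ring
  calc (4 * Real.pi * T) ^ (-((3 : ℕ) : ℝ) / 2) * Real.exp (-‖z - y‖ ^ 2 / (4 * T)) *
        ((4 * Real.pi * t) ^ (-((3 : ℕ) : ℝ) / 2) * Real.exp (-‖y‖ ^ 2 / (4 * t)))
      = ((4 * Real.pi * T) ^ (-((3 : ℕ) : ℝ) / 2) * (4 * Real.pi * t) ^ (-((3 : ℕ) : ℝ) / 2)) *
          (Real.exp (-‖z - y‖ ^ 2 / (4 * T)) * Real.exp (-‖y‖ ^ 2 / (4 * t))) := by ring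
    _ = ((4 * Real.pi * (t + T)) ^ (-((3 : ℕ) : ℝ) / 2) * (4 * Real.pi * (t * T / (t + T))) ^ (-((3 : ℕ) : ℝ) / 2)) *
          (Real.exp (-‖z‖ ^ 2 / (4 * (t + T))) *
            Real.exp (-‖y - (t / (t + T)) • z‖ ^ 2 / (4 * (t * T / (t + T))))) := by rw [hpre, hexp]
    _ = (4 * Real.pi * (t + T)) ^ (-((3 : ℕ) : ℝ) / 2) * Real.exp (-‖z‖ ^ 2 / (4 * (t + T))) *
          ((4 * Real.pi * (t * T / (t + T))) ^ (-((3 : ℕ) : ℝ) / 2) *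
            Real.exp (-‖y - (t / (t + T)) • z‖ ^ 2 / (4 * (t * T / (t + T))))) := by ring

/-! ### Shifted Gaussian second moments -/

/-- `⟪w,a⟫⟪w,b⟫G_σ(w)` is integrable. -/
theorem integrable_inner_mul_inner_mul_heatKernel {σ : ℝ} (hσ : 0 < σ) (a b : EuclideanSpace ℝ (Fin 3)) :
    Integrable fun w : EuclideanSpace ℝ (Fin 3) => ⟪w, a⟫ * ⟪w, b⟫ * heatKernel σ w := by
  refine (((integrable_norm_sq_mul_heatKernel (E := EuclideanSpace ℝ (Fin 3)) hσ).const_mul (‖a‖ * ‖b‖))).mono'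
    ((((continuous_id.inner continuous_const).mul (continuous_id.inner continuous_const)).mul
      (continuous_heatKernel σ)).aestronglyMeasurable) (Eventually.of_forall fun w => ?_)
  have hG : 0 ≤ heatKernel σ w := (heatKernel_pos hσ w).le
  rw [Real.norm_eq_abs, abs_mul, abs_mul, abs_of_nonneg hG]
  have ha : |⟪w, a⟫| ≤ ‖w‖ * ‖a‖ := abs_real_inner_le_norm w a
  have hb : |⟪w, b⟫| ≤ ‖w‖ * ‖b‖ := abs_real_inner_le_norm w b
  calc |⟪w, a⟫| * |⟪w, b⟫| * heatKernel σ w ≤ (‖w‖ * ‖a‖) * (‖w‖ * ‖b‖) * heatKernel σ w := by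
        gcongr
    _ = ‖a‖ * ‖b‖ * (‖w‖ ^ 2 * heatKernel σ w) := by ring

/-- `⟪w,a⟫G_σ(w)` is integrable. -/
theorem integrable_inner_mul_heatKernel {σ : ℝ} (hσ : 0 < σ) (a : EuclideanSpace ℝ (Fin 3)) :
    Integrable fun w : EuclideanSpace ℝ (Fin 3) => ⟪w, a⟫ * heatKernel σ w := by
  refine (((integrable_heatKernel_mul_norm (E := EuclideanSpace ℝ (Fin 3)) hσ).const_mul ‖a‖)).mono'
    (((continuous_id.inner continuous_const).mul (continuous_heatKernel σ)).aestronglyMeasurable)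
    (Eventually.of_forall fun w => ?_)
  have hG : 0 ≤ heatKernel σ w := (heatKernel_pos hσ w).le
  rw [Real.norm_eq_abs, abs_mul, abs_of_nonneg hG]
  have ha : |⟪w, a⟫| ≤ ‖w‖ * ‖a‖ := abs_real_inner_le_norm w a
  calc |⟪w, a⟫| * heatKernel σ w ≤ ‖w‖ * ‖a‖ * heatKernel σ w := by gcongr
    _ = ‖a‖ * (heatKernel σ w * ‖w‖) := by ring

/-- **Shifted second moments.**  `∫ G_σ(y − m)⟪y,a⟫⟪y,b⟫ dy = ⟪m,a⟫⟪m,b⟫ + 2σ⟪a,b⟫` (`σ > 0`). -/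
theorem integral_heatKernel_shift_mul_inner_mul_inner {σ : ℝ} (hσ : 0 < σ) (m a b : EuclideanSpace ℝ (Fin 3)) :
    ∫ y : EuclideanSpace ℝ (Fin 3), heatKernel σ (y - m) * (⟪y, a⟫ * ⟪y, b⟫) = ⟪m, a⟫ * ⟪m, b⟫ + 2 * σ * ⟪a, b⟫ := by
  rw [← integral_add_right_eq_self _ m]
  simp only [add_sub_cancel_right]
  have hsplit : (fun w : EuclideanSpace ℝ (Fin 3) => heatKernel σ w * (⟪w + m, a⟫ * ⟪w + m, b⟫)) =
      fun w => (⟪w, a⟫ * ⟪w, b⟫ * heatKernel σ w + ⟪m, b⟫ * (⟪w, a⟫ * heatKernel σ w)) +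
        (⟪m, a⟫ * (⟪w, b⟫ * heatKernel σ w) + ⟪m, a⟫ * ⟪m, b⟫ * heatKernel σ w) := by
    funext w
    rw [inner_add_left, inner_add_left]
    ring
  rw [hsplit, integral_add, integral_add, integral_add, integral_const_mul, integral_const_mul, integral_const_mul,
    integral_inner_mul_inner_mul_heatKernel hσ a b, integral_inner_mul_heatKernel_eq_zero hσ a,
    integral_inner_mul_heatKernel_eq_zero hσ b, integral_heatKernel_eq_one_holds hσ]
  · ring
  · exact (integrable_inner_mul_heatKernel hσ b).const_mul _
  · exact (integrable_heatKernel_holds hσ).const_mul _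
  · exact integrable_inner_mul_inner_mul_heatKernel hσ a b
  · exact (integrable_inner_mul_heatKernel hσ a).const_mul _
  · exact (integrable_inner_mul_inner_mul_heatKernel hσ a b).add ((integrable_inner_mul_heatKernel hσ a).const_mul _)
  · exact ((integrable_inner_mul_heatKernel hσ b).const_mul _).add ((integrable_heatKernel_holds hσ).const_mul _)


/-- Integrability of the shifted quadratic moment integrand `G_σ(y − m)⟪y,a⟫⟪y,b⟫`. -/
theorem integrable_heatKernel_shift_mul_inner_mul_inner {σ : ℝ} (hσ : 0 < σ) (m a b : EuclideanSpace ℝ (Fin 3)) :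
    Integrable fun y : EuclideanSpace ℝ (Fin 3) => heatKernel σ (y - m) * (⟪y, a⟫ * ⟪y, b⟫) := by
  have hsplit : (fun w : EuclideanSpace ℝ (Fin 3) => heatKernel σ w * (⟪w + m, a⟫ * ⟪w + m, b⟫)) =
      fun w => (⟪w, a⟫ * ⟪w, b⟫ * heatKernel σ w + ⟪m, b⟫ * (⟪w, a⟫ * heatKernel σ w)) +
        (⟪m, a⟫ * (⟪w, b⟫ * heatKernel σ w) + ⟪m, a⟫ * ⟪m, b⟫ * heatKernel σ w) := by
    funext w
    rw [inner_add_left, inner_add_left]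
    ring
  have hint : Integrable fun w : EuclideanSpace ℝ (Fin 3) => heatKernel σ w * (⟪w + m, a⟫ * ⟪w + m, b⟫) := by
    rw [hsplit]
    exact ((integrable_inner_mul_inner_mul_heatKernel hσ a b).add ((integrable_inner_mul_heatKernel hσ a).const_mul _)).add
      (((integrable_inner_mul_heatKernel hσ b).const_mul _).add ((integrable_heatKernel_holds hσ).const_mul _))
  have h := hint.comp_sub_right m
  refine h.congr (Eventually.of_forall fun y => ?_)
  simp only [sub_add_cancel]

/-- **Shifted second moment of the norm.**  `∫ G_σ(y − m)‖y‖² dy = ‖m‖² + 6σ`. -/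
theorem integral_heatKernel_shift_mul_norm_sq {σ : ℝ} (hσ : 0 < σ) (m : EuclideanSpace ℝ (Fin 3)) :
    ∫ y : EuclideanSpace ℝ (Fin 3), heatKernel σ (y - m) * ‖y‖ ^ 2 = ‖m‖ ^ 2 + 6 * σ := by
  set e : Fin 3 → EuclideanSpace ℝ (Fin 3) := fun i => EuclideanSpace.single i (1 : ℝ) with he
  have hsq : ∀ y : EuclideanSpace ℝ (Fin 3), ‖y‖ ^ 2 = ∑ i, ⟪y, e i⟫ * ⟪y, e i⟫ := by
    intro y
    rw [EuclideanSpace.real_norm_sq_eq]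
    refine Finset.sum_congr rfl fun i _ => ?_
    rw [he, EuclideanSpace.inner_single_right, RCLike.conj_to_real, one_mul, sq]
  have hpt : ∀ y : EuclideanSpace ℝ (Fin 3), heatKernel σ (y - m) * ‖y‖ ^ 2 =
      ∑ i, heatKernel σ (y - m) * (⟪y, e i⟫ * ⟪y, e i⟫) := by
    intro y
    rw [hsq, Finset.mul_sum]
  simp_rw [hpt]
  rw [integral_finsetSum _ fun i _ => integrable_heatKernel_shift_mul_inner_mul_inner hσ m (e i) (e i)]
  simp_rw [integral_heatKernel_shift_mul_inner_mul_inner hσ]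
  rw [Finset.sum_add_distrib, ← hsq m]
  have hee : ∀ i, ⟪e i, e i⟫ = (1 : ℝ) := fun i => by
    rw [he, EuclideanSpace.inner_single_right]
    simp
  simp only [hee, mul_one, Finset.sum_const, Finset.card_univ, Fintype.card_fin, nsmul_eq_mul, Nat.cast_ofNat]
  ring

/-- **The inner axis integral.**  For `t, T > 0`:
`∫ G_T(x₀ − xc)·G_t(x − x₀)·⟪x−x₀,a⟫⟪x−x₀,b⟫ dx₀ = G_{t+T}(x − xc)·[(t/(t+T))²⟪x−xc,a⟫⟪x−xc,b⟫ + 2(tT/(t+T))⟪a,b⟫]`. -/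
theorem integral_axis_heatKernel_mul_inner_mul_inner {t T : ℝ} (ht : 0 < t) (hT : 0 < T)
    (xc x a b : EuclideanSpace ℝ (Fin 3)) :
    ∫ x₀ : EuclideanSpace ℝ (Fin 3), heatKernel T (x₀ - xc) * (heatKernel t (x - x₀) * (⟪x - x₀, a⟫ * ⟪x - x₀, b⟫)) =
      heatKernel (t + T) (x - xc) *
        ((t / (t + T)) ^ 2 * (⟪x - xc, a⟫ * ⟪x - xc, b⟫) + 2 * (t * T / (t + T)) * ⟪a, b⟫) := by
  have htT : 0 < t + T := by linarith
  have hσ : 0 < t * T / (t + T) := by positivity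
  rw [← integral_sub_left_eq_self _ volume x]
  have hpt : ∀ y : EuclideanSpace ℝ (Fin 3),
      heatKernel T (x - y - xc) * (heatKernel t (x - (x - y)) * (⟪x - (x - y), a⟫ * ⟪x - (x - y), b⟫)) =
        heatKernel (t + T) (x - xc) *
          (heatKernel (t * T / (t + T)) (y - (t / (t + T)) • (x - xc)) * (⟪y, a⟫ * ⟪y, b⟫)) := by
    intro y
    rw [sub_sub_cancel, sub_right_comm]
    have hprod := heatKernel_mul_heatKernel_eq ht hT (x - xc) y
    calc heatKernel T (x - xc - y) * (heatKernel t y * (⟪y, a⟫ * ⟪y, b⟫))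
        = (heatKernel T (x - xc - y) * heatKernel t y) * (⟪y, a⟫ * ⟪y, b⟫) := by ring
      _ = heatKernel (t + T) (x - xc) *
          (heatKernel (t * T / (t + T)) (y - (t / (t + T)) • (x - xc)) * (⟪y, a⟫ * ⟪y, b⟫)) := by rw [hprod]; ring
  simp_rw [hpt]
  rw [integral_const_mul, integral_heatKernel_shift_mul_inner_mul_inner hσ, real_inner_smul_left, real_inner_smul_left]
  ring

/-- **The inner axis integral of the norm square.**
`∫ G_T(x₀ − xc)·G_t(x − x₀)·‖x−x₀‖² dx₀ = G_{t+T}(x − xc)·[(t/(t+T))²‖x−xc‖² + 6tT/(t+T)]`. -/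
theorem integral_axis_heatKernel_mul_norm_sq {t T : ℝ} (ht : 0 < t) (hT : 0 < T) (xc x : EuclideanSpace ℝ (Fin 3)) :
    ∫ x₀ : EuclideanSpace ℝ (Fin 3), heatKernel T (x₀ - xc) * (heatKernel t (x - x₀) * ‖x - x₀‖ ^ 2) =
      heatKernel (t + T) (x - xc) * ((t / (t + T)) ^ 2 * ‖x - xc‖ ^ 2 + 6 * (t * T / (t + T))) := by
  have htT : 0 < t + T := by linarith
  have hσ : 0 < t * T / (t + T) := by positivity
  rw [← integral_sub_left_eq_self _ volume x]
  have hpt : ∀ y : EuclideanSpace ℝ (Fin 3),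
      heatKernel T (x - y - xc) * (heatKernel t (x - (x - y)) * ‖x - (x - y)‖ ^ 2) =
        heatKernel (t + T) (x - xc) * (heatKernel (t * T / (t + T)) (y - (t / (t + T)) • (x - xc)) * ‖y‖ ^ 2) := by
    intro y
    rw [sub_sub_cancel, sub_right_comm]
    have hprod := heatKernel_mul_heatKernel_eq ht hT (x - xc) y
    calc heatKernel T (x - xc - y) * (heatKernel t y * ‖y‖ ^ 2)
        = (heatKernel T (x - xc - y) * heatKernel t y) * ‖y‖ ^ 2 := by ring
      _ = heatKernel (t + T) (x - xc) * (heatKernel (t * T / (t + T)) (y - (t / (t + T)) • (x - xc)) * ‖y‖ ^ 2) := by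
          rw [hprod]; ring
  simp_rw [hpt]
  rw [integral_const_mul, integral_heatKernel_shift_mul_norm_sq hσ, norm_smul, Real.norm_eq_abs,
    abs_of_pos (by positivity), mul_pow]

end Summit.NavierStokesRegularity.NavierStokesRegularity.Theorems.HalfSpaceWindowDoorCirculationCarryingRigidityGaussProduct

end
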